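/-
Copyright: b2b-lace packet (Lean typing seat 1, gen 41).  [FvdH17] §5.1 "Elements of the bounds" / §4.2 (4.16),
(4.18) and [NoBLE17] §5.3.2 (5.40): the ENTRY INEQUALITIES of the sharp payload matrix `A♯` — the sums
`Σ_{y≠0} 𝓑_{≥2,≥1}(y,v)` and `Σ_{y≠0} 𝓑_{1̲,≥1}(y,v)` of the percolation bubble letter at the apex `0`, over all
apexes `v`, and over the unit-vector apexes — in terms of the Bubble cell with printed constants (full currency,
general indices; exact closed-trail count at the apex `0`, a count majorant at a general apex), over the tree objects `Letters.perc` (`NoblePercLetters`),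
`repBubble` (`GeneralizedDisjointOccurrence` / `RepulsiveBubbleExtractionIndep`), the remainder slots of
`NbwRemainderFramePrinted`, the printed-constant tails of `NobleEntryVecPETwo`, and a currency bridge to the generic
rows 1–2 module `NobleBubbleLetterSums` (`bubbleSlotR`); plus the FLOOR-tier forms of the `N = 1` entries `(P⃗^E)_1`,
`(P⃗^S)_1` in the same cells.  Proofs only; no named fact; no numeral; no dimension.
-/
import Literature.Probability.FitznerVanDerHofstad2017.NobleEntryVecPETwo
import Literature.Probability.FitznerVanDerHofstad2017.NobleBubbleLetterSums
import HarnessLib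

/-!
# [FvdH17] §5.1 / [NoBLE17] (5.40), (5.41): the `A♯` entries `Σ_{y≠0} 𝓑_{≥2,≥1}(y,v) ≤ Bound[Bubble, 3, M]` and
`Σ_{y≠0} 𝓑_{1̲,≥1}(y,v) ≤ Σ_y 𝓑_{≥1,≥1}(y,v) ≤ Bound[Bubble, 2, M]` (full currency; apex `0`, all `v`, unit vectors `v`)

CITATION HEADER (PLACEMENT v2). This module is part of a certified REPRODUCTION of:
R. Fitzner, R. van der Hofstad, *Mean-field behavior for nearest-neighbor percolation in `d > 10`*,
Electron. J. Probab. **22** (2017) no. 43 [FvdH17] (extended version arXiv:1506.07977v2), §5.1 "Elements of the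
bounds" (arXiv v2 p. 49), §4.2 (4.16) (p. 36: the repulsive bubble `𝓑_{m₁,m₂}(x,y)` as a maximum over the two
disjointness readings), (4.18) and the display after it (p. 36: repulsive diagrams bounded by simple diagrams with
closed-trail counts and simple-random-walk tails), §5.4 closing paragraph (p. 56); of
R. Fitzner, R. van der Hofstad, *Generalized approach to the non-backtracking lace expansion*, Probab. Theory Related
Fields **169** (2017) 1041–1119 [NoBLE17], §5.3.2 (5.40) (p. 1098: the bubble with one- and two-G tails) and the
first display of §5.3.2 (p. 1097: each tail `(2d)^M K_{n,M}`), §5.3.1 and (5.13) (pp. 1091, 1096–1097: the printed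
constants `(2dp)^M ≤ ((2d/(2d−1))Γ₁)^M`, `Γ̄₂ ≤ ((2d−2)/(2d−1))Γ₂`); and of the authors' notebook `Percolation.nb`
(www.fitzner.nl/noble/), cells 11–12 (`Bound[Bubble,m,s]`).
Origin: build `lace` (host summit CriticalPhenomena), Lean typing seat; Row D♯ of the cell's lemma DAG (the `A♯`
entry inequalities, GE-shape), leaves D♯(0,2), D♯(0,1), D♯(2,2), D♯(2,1), D♯(1,2), D♯(1,1); companion of `NobleEntryVecPEZero` / `NobleEntryVecPETwo`.

WHAT THIS FILE DOES.  For the percolation letter table the at-least-indexed bubble letter is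
`𝓑_{≥m₁,≥m₂}(y,x) = ofReal (repBubble d p m₁ m₂ y x)` (`perc_B_ge`), and the landed slot theorem
`sum_repBubble_le_slots` ([NoBLE17] (5.40) at abstract remainder-kernel constants, the closed-trail extraction (4.18)
discharged) bounds `Σ_{y∈S} repBubble d p m₁ m₂ y x` for every finite `S`.  At the apex `x = 0`, endpoint set `univ`,
with the landed PRINTED kernel constants `isRemKernelConst_srwK_univ` (`R_n = (2d)^M K_{n,M}(0)` for the compositions
`[M]`, `[M−m₂, m₂]`; the two-piece constant needs `2·2+1 ≤ d`) and the printed-constant tails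
`srwK_tail_le_printed` (`NobleEntryVecPETwo`), this gives:

* `bubblePrintedR d p Γ₁ Γ₂ m₁ m₂ M` — the right-hand side of the Bubble cell as a TOTAL real function (finite sum over
  `L ∈ [m₁+m₂, M)` of `(L+1−m₁−m₂)·#{closed L-trails at 0}·p^L`, plus the tails
  `(M−m₁−m₂)·((2d/(2d−1))Γ₁)^M·((2d−2)/(2d−1))Γ₂·K_{1,M}(0)` and `((2d/(2d−1))Γ₁)^M·(((2d−2)/(2d−1))Γ₂)²·K_{2,M}(0)`;
  multiplicities = those of the landed slot theorem), with `sum_repBubble_zero_le_bubblePrintedR`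
  (`Σ_{y∈S} repBubble d p m₁ m₂ y 0 ≤ bubblePrintedR …`, all finite `S`; `5 ≤ d`, `p < p_c`, `m₂ ≤ M`, `(2d−1)p ≤ Γ₁`,
  `nobleF2 d p ≤ Γ₂`), `bubblePrintedR_nonneg`, and the relation to the landed half cell
  `halfBubblePrintedR_eq_half_bubblePrintedR : halfBubblePrintedR d p Γ₁ Γ₂ n M = ½·bubblePrintedR d p Γ₁ Γ₂ n n M`;
* `tsum_perc_B_zero_le_ofReal` — `Σ_y 𝓑_{≥m₁,≥m₂}(y,0) ≤ ofReal (bubblePrintedR d p Γ₁ Γ₂ m₁ m₂ M)` for the instance's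
  letter (finite partial sums, `ENNReal.tsum_eq_iSup_sum`);
* `percB_eq_one_le_ge_one` — the monotone embedding of the exact first index into the at-least index,
  `𝓑_{1̲,≥1}(y,v) ≤ 𝓑_{≥1,≥1}(y,v)` (`perc_B_le_floor`, (4.16));
* **the row-0 entries of `A♯`**: `perc_ASharp_zero_two_le_ofReal :
  Σ'_y (1−δ_{y,0}) 𝓑_{≥2,≥1}(y,0) ≤ ofReal (bubblePrintedR d p Γ₁ Γ₂ 2 1 M)` (notebook `Bound[Bubble,3,s]`, full currency)
  and `perc_ASharp_zero_one_le_ofReal : Σ'_y (1−δ_{y,0}) 𝓑_{1̲,≥1}(y,0) ≤ ofReal (bubblePrintedR d p Γ₁ Γ₂ 1 1 M)`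
  (notebook `Bound[Bubble,2,s]` in FULL currency — the GE-shape: the exact index is only embedded, no bond-avoidance is
  used), both under `5 ≤ d`, `p < p_c`, `(2d−1)p ≤ Γ₁`, `nobleF2 d p ≤ Γ₂`, `1 ≤ M`.  The left-hand sides are literally
  the row-0 right-hand sides of the sharp payload matrix `(A♯)_{0,b} = Σ_y (1−δ_{y,0}) 𝓑_{b̲/≥b, ≥1}(y,0)` at the
  percolation letters (the cell's Row D♯ typed targets, leaves D♯(0,2) / D♯(0,1));
* **the general-apex cell and the `⨆ v` entries of `A♯`** (§D): `bubblePrintedRN d p Γ₁ Γ₂ m₁ m₂ M N` — the same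
  right-hand side with the closed-trail count replaced by a majorant `N L ≥ #trailWordsTo d L x` (uniform in the apex;
  `bubblePrintedRN_count_zero`: with the exact count at `0` it is `bubblePrintedR`), `sum_repBubble_le_bubblePrintedRN`
  (`Σ_{y∈S} repBubble d p m₁ m₂ y x ≤ bubblePrintedRN …` at ANY apex `x`, endpoint set `univ`, printed kernel constants),
  `bubblePrintedRN_nonneg`, `tsum_perc_B_le_ofReal_of_count`, `tsum_kdc_perc_B_le_ofReal_of_count`, and the entries
  `perc_ASharp_two_two_le_max : (⨆ v, Σ'_y (1−δ_{y,0}) 𝓑_{≥2,≥1}(y,v)) ≤ max (ofReal (bubblePrintedRN … 2 1 M N₀))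
  (ofReal (bubblePrintedRN … 2 1 M N₁))` (`N₀` a majorant at the apex `0`, `N₁` off `0`), `perc_ASharp_two_one_le_max`
  (GE-shape, indices `(1,1)`), `perc_ASharp_one_two_le_ofReal : (⨆ v, twoDD v * Σ'_y (1−δ_{y,0}) 𝓑_{≥2,≥1}(y,v)) ≤
  ofReal (bubblePrintedRN … 2 1 M N)` (`N` a majorant over the `2d` unit vectors; `twoDD v = 𝟙{|v|=1}`) and
  `perc_ASharp_one_one_le_ofReal` (GE-shape) — leaves D♯(2,2) / D♯(2,1) / D♯(1,2) / D♯(1,1); the majorants `N` are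
  hypotheses (the cell's numerics seats discharge them from the trail-count tables), exactly as in the carver's stubs;
* **currency bridge** (§E): `bubbleSlotR_printed_le_bubblePrintedRN` — the generic right-hand side `bubbleSlotR` of the
  landed rows 1–2 module `NobleBubbleLetterSums` at the printed kernel constants `(2d)^M K_{n,M}(0)` is `≤ bubblePrintedRN`
  (so its `iSup_*` leaves, instantiated printed, are dominated by the §D numbers);
* **FLOOR-tier forms of the `N = 1` entries** (§F): `perc_vecPE_one_le_ofReal_floor : vecPE (Letters.perc d p) 1 ≤
  ofReal (trianglePrintedR d p Γ₁ Γ₂ 3 M)` and `perc_vecPS_one_le_ofReal_floor : vecPS (Letters.perc d p) 1 ≤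
  ofReal (bubblePrintedR d p Γ₁ Γ₂ 3 1 M + trianglePrintedR d p Γ₁ Γ₂ 3 M)` (`7 ≤ d`, `2 ≤ M`): the exact unit leg `1̲`
  of `T_{1,1̲,1}` / `B_{3,1̲}` read as `≥ 1` (`perc_T_le_floor`, `perc_B_le_floor`) and the landed Triangle cell of
  `NobleEntryVecPETwo` / the Bubble cell of §A applied — a LOSSY tier (the notebook prices an exact leg without a free
  line: `Bound[PE,1] = Bound[Bubble,3]`, `Bound[PS,1] = Bound[Loop,4] + Bound[Bubble,3]`; that extraction is not typed
  here), with the pointwise steps `perc_vecPE_one_le_tsum_floor`, `perc_vecPS_one_le_add_floor`.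

Any `d ≥ 5` (§E: `d ≥ 2`; §F: `d ≥ 7`); nothing landed is modified; no cited hypothesis — every statement is a kernel-proved inequality between
the landed definitions.  The identification of `bubblePrintedR` / `bubblePrintedRN` with the notebook's table expressions (`nrBAW[j,d,{0}]`,
`I[n,R,{0}]`, `z[o]`, `VarGamma2`) and every numerical reading are NOT part of this module.
-/

noncomputable section

namespace Literature.Probability.FitznerVanDerHofstad2017

open MeasureTheory Finset
open scoped BigOperators ENNReal
open Literature.Probability.LatticeModels Literature.Probability.Percolation
open Literature.Barriers.CriticalPhenomena
open Literature.Probability.FitznerVanDerHofstad2017.NobleBlocks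

variable {d : ℕ}

/-! ## A. The Bubble cell (full currency, general indices) with printed constants as a total real function -/

/-- `Bound[Bubble, m₁+m₂, M]`-shape with the printed constants: the right-hand side of the landed slot theorem
`sum_repBubble_le_slots` ([NoBLE17] (5.40)) at the apex `x = 0` with each tail `p^M Γ̄₂ⁿ (2d)^M K_{n,M}(0)` dominated by
`((2d/(2d−1))Γ₁)^M (((2d−2)/(2d−1))Γ₂)ⁿ K_{n,M}(0)`, as a total real function of `(d, p, Γ₁, Γ₂, m₁, m₂, M)`.
[cite: FitznerVanDerHofstad2016NoBLE, §5.3.2 (5.40) p. 1098, first display p. 1097; §5.3.1 and (5.13) pp. 1091, 1096–1097]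
[cite: FitznerVanDerHofstad2017, §4.2 (4.16), (4.18) (arXiv:1506.07977v2 p. 36); notebook Percolation.nb cells 11–12] -/
def bubblePrintedR (d : ℕ) (p Γ₁ Γ₂ : ℝ) (m₁ m₂ M : ℕ) : ℝ :=
  (∑ L ∈ Finset.Ico (m₁ + m₂) M, ((L + 1 - m₁ - m₂ : ℕ) : ℝ) * ((trailWordsTo d L 0).card : ℝ) * p ^ L) +
    ((M - m₁ - m₂ : ℕ) : ℝ) * ((2 * d / (2 * d - 1) * Γ₁) ^ M * ((2 * d - 2) / (2 * d - 1) * Γ₂ * srwK d 1 M 0)) +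
      (2 * d / (2 * d - 1) * Γ₁) ^ M * (((2 * d - 2) / (2 * d - 1) * Γ₂) ^ 2 * srwK d 2 M 0)

/-- The landed half cell of `NobleEntryVecPEZero` is half of the full cell at equal indices:
`halfBubblePrintedR d p Γ₁ Γ₂ n M = ½ · bubblePrintedR d p Γ₁ Γ₂ n n M`.
[cite: FitznerVanDerHofstad2017, §4.2 (4.19)–(4.21) (arXiv:1506.07977v2 pp. 36–37); notebook Percolation.nb cells 11, 16] -/
theorem halfBubblePrintedR_eq_half_bubblePrintedR (d : ℕ) (p Γ₁ Γ₂ : ℝ) (n M : ℕ) :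
    halfBubblePrintedR d p Γ₁ Γ₂ n M = 1 / 2 * bubblePrintedR d p Γ₁ Γ₂ n n M := by
  have h1 : ∀ L : ℕ, L + 1 - 2 * n = L + 1 - n - n := fun L => by omega
  have h2 : M - 2 * n = M - n - n := by omega
  have h3 : n + n = 2 * n := by omega
  simp only [halfBubblePrintedR, bubblePrintedR, h1, h2, h3]

/-- **The repulsive bubble summed over a finite set is dominated by the Bubble cell**:
`Σ_{y∈S} repBubble d p m₁ m₂ y 0 ≤ bubblePrintedR d p Γ₁ Γ₂ m₁ m₂ M` (`5 ≤ d`, `p < p_c`, `m₂ ≤ M`, `(2d−1)p ≤ Γ₁`,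
`nobleF2 d p ≤ Γ₂`) — the landed slot theorem at `x = 0`, `X = univ`, slots `(2d)^M K_{n,M}(0)` for `[M]`, `[M−m₂, m₂]`
(the two-piece constant needs `2·2+1 ≤ d`), then `srwK_tail_le_printed`.
[cite: FitznerVanDerHofstad2016NoBLE, §5.3.2 (5.40) p. 1098, first display p. 1097]
[cite: FitznerVanDerHofstad2017, §4.2 (4.16), (4.18) and the display after it (arXiv:1506.07977v2 p. 36)] -/
theorem sum_repBubble_zero_le_bubblePrintedR (hd : 5 ≤ d) (p : unitInterval) (hp : p < criticalProbI d)
    {m₁ m₂ M : ℕ} (hm : m₂ ≤ M) {Γ₁ Γ₂ : ℝ} (hΓ1 : (2 * d - 1) * (p : ℝ) ≤ Γ₁) (hΓ2 : nobleF2 d p ≤ Γ₂)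
    (S : Finset (Site d)) :
    ∑ y ∈ S, repBubble d p m₁ m₂ y 0 ≤ bubblePrintedR d p Γ₁ Γ₂ m₁ m₂ M := by
  have hR₁ := isRemKernelConst_srwK_univ_of_eq (d := d) [M] (n := 1) (M := M) rfl (by simp) (by omega) (by omega)
  have hR₂ := isRemKernelConst_srwK_univ_of_eq (d := d) [M - m₂, m₂] (n := 2) (M := M) rfl
    (by simp; omega) (by omega) (by omega)
  refine (sum_repBubble_le_slots (by omega) p hp hm (Set.mem_univ _) hR₁ hR₂ S).trans ?_
  unfold bubblePrintedR
  refine add_le_add (add_le_add le_rfl ?_) ?_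
  · refine mul_le_mul_of_nonneg_left ?_ (Nat.cast_nonneg _)
    simpa only [pow_one] using srwK_tail_le_printed (by omega) p hΓ1 hΓ2 1 M
  · exact srwK_tail_le_printed (by omega) p hΓ1 hΓ2 2 M

/-- Under the cell's hypotheses `0 ≤ bubblePrintedR d p Γ₁ Γ₂ m₁ m₂ M` (the case `S = ∅`).
[cite: FitznerVanDerHofstad2016NoBLE, §5.3.2 (5.40) p. 1098] -/
theorem bubblePrintedR_nonneg (hd : 5 ≤ d) (p : unitInterval) (hp : p < criticalProbI d) {m₁ m₂ M : ℕ}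
    (hm : m₂ ≤ M) {Γ₁ Γ₂ : ℝ} (hΓ1 : (2 * d - 1) * (p : ℝ) ≤ Γ₁) (hΓ2 : nobleF2 d p ≤ Γ₂) :
    0 ≤ bubblePrintedR d p Γ₁ Γ₂ m₁ m₂ M := by
  simpa using sum_repBubble_zero_le_bubblePrintedR hd p hp hm hΓ1 hΓ2 ∅

/-! ## B. The instance's bubble letter summed over `ℤ^d` -/

/-- **`Σ_y 𝓑_{≥m₁,≥m₂}(y,0) ≤ Bound[Bubble, m₁+m₂, M]`** for the percolation letter table
(`perc_B_ge : 𝓑 = ofReal repBubble`, finite partial sums, `ENNReal.tsum_eq_iSup_sum`).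
[cite: FitznerVanDerHofstad2017, §4.2 (4.16), (4.18) (arXiv:1506.07977v2 p. 36); §5.4 closing paragraph (p. 56)]
[cite: FitznerVanDerHofstad2016NoBLE, §5.3.2 (5.40) p. 1098] -/
theorem tsum_perc_B_zero_le_ofReal (hd : 5 ≤ d) (p : unitInterval) (hp : p < criticalProbI d) {m₁ m₂ M : ℕ}
    (hm : m₂ ≤ M) {Γ₁ Γ₂ : ℝ} (hΓ1 : (2 * d - 1) * (p : ℝ) ≤ Γ₁) (hΓ2 : nobleF2 d p ≤ Γ₂) :
    ∑' y, (Letters.perc d p).B (.ge m₁) (.ge m₂) y 0 ≤ ENNReal.ofReal (bubblePrintedR d p Γ₁ Γ₂ m₁ m₂ M) := by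
  rw [ENNReal.tsum_eq_iSup_sum]
  refine iSup_le fun S => ?_
  calc ∑ y ∈ S, (Letters.perc d p).B (.ge m₁) (.ge m₂) y 0 = ENNReal.ofReal (∑ y ∈ S, repBubble d p m₁ m₂ y 0) := by
        rw [ENNReal.ofReal_sum_of_nonneg fun y _ => repBubble_nonneg p _ _ _ _]
        exact Finset.sum_congr rfl fun y _ => perc_B_ge p _ _ _ _
    _ ≤ _ := ENNReal.ofReal_le_ofReal (sum_repBubble_zero_le_bubblePrintedR hd p hp hm hΓ1 hΓ2 S)

/-! ## C. The row-0 entries of the sharp payload matrix `A♯` -/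

/-- The exact first index embeds into the at-least index: `𝓑_{1̲,≥1}(y,v) ≤ 𝓑_{≥1,≥1}(y,v)` (a path of length exactly
`1` has length `≥ 1`; `perc_B_le_floor`). [cite: FitznerVanDerHofstad2017, §4.2 (4.16) (arXiv:1506.07977v2 p. 36)] -/
theorem percB_eq_one_le_ge_one (p : unitInterval) (y v : Site d) :
    (Letters.perc d p).B (.eq 1) (.ge 1) y v ≤ (Letters.perc d p).B (.ge 1) (.ge 1) y v :=
  perc_B_le_floor p (.eq 1) (.ge 1) y v

/-- **Leaf D♯(0,2): `Σ'_y (1−δ_{y,0}) 𝓑_{≥2,≥1}(y,0) ≤ ofReal (Bound[Bubble, 3, M])`** (full currency; `5 ≤ d`,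
`p < p_c`, `(2d−1)p ≤ Γ₁`, `nobleF2 d p ≤ Γ₂`, `1 ≤ M`) — the row-0, column-2 right-hand side of the sharp payload
matrix at the percolation letters. [cite: FitznerVanDerHofstad2017, §5.1 "Elements of the bounds" (arXiv:1506.07977v2 p. 49), §4.2 (4.16), (4.18) (p. 36); notebook Percolation.nb cells 11–12]
[cite: FitznerVanDerHofstad2016NoBLE, §5.3.2 (5.40) p. 1098] -/
theorem perc_ASharp_zero_two_le_ofReal (hd : 5 ≤ d) (p : unitInterval) (hp : p < criticalProbI d) {Γ₁ Γ₂ : ℝ}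
    (hΓ1 : (2 * d - 1) * (p : ℝ) ≤ Γ₁) (hΓ2 : nobleF2 d p ≤ Γ₂) {M : ℕ} (hM : 1 ≤ M) :
    ∑' y, kdc y 0 * (Letters.perc d p).B (.ge 2) (.ge 1) y 0 ≤ ENNReal.ofReal (bubblePrintedR d p Γ₁ Γ₂ 2 1 M) :=
  (ENNReal.tsum_le_tsum fun y => (mul_le_mul' (kdc_le_one y 0) le_rfl).trans_eq (one_mul _)).trans
    (tsum_perc_B_zero_le_ofReal hd p hp (m₁ := 2) (m₂ := 1) hM hΓ1 hΓ2)

/-- **Leaf D♯(0,1), GE-shape: `Σ'_y (1−δ_{y,0}) 𝓑_{1̲,≥1}(y,0) ≤ ofReal (Bound[Bubble, 2, M])`** (FULL currency — no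
`½`, no bond avoidance; `5 ≤ d`, `p < p_c`, `(2d−1)p ≤ Γ₁`, `nobleF2 d p ≤ Γ₂`, `1 ≤ M`) — the row-0, column-1
right-hand side of the sharp payload matrix at the percolation letters, through `percB_eq_one_le_ge_one`.
[cite: FitznerVanDerHofstad2017, §5.1 "Elements of the bounds" (arXiv:1506.07977v2 p. 49), §4.2 (4.16), (4.18) (p. 36); notebook Percolation.nb cells 11–12]
[cite: FitznerVanDerHofstad2016NoBLE, §5.3.2 (5.40) p. 1098] -/
theorem perc_ASharp_zero_one_le_ofReal (hd : 5 ≤ d) (p : unitInterval) (hp : p < criticalProbI d) {Γ₁ Γ₂ : ℝ}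
    (hΓ1 : (2 * d - 1) * (p : ℝ) ≤ Γ₁) (hΓ2 : nobleF2 d p ≤ Γ₂) {M : ℕ} (hM : 1 ≤ M) :
    ∑' y, kdc y 0 * (Letters.perc d p).B (.eq 1) (.ge 1) y 0 ≤ ENNReal.ofReal (bubblePrintedR d p Γ₁ Γ₂ 1 1 M) :=
  (ENNReal.tsum_le_tsum fun y =>
      (mul_le_mul' (kdc_le_one y 0) (percB_eq_one_le_ge_one p y 0)).trans_eq (one_mul _)).trans
    (tsum_perc_B_zero_le_ofReal hd p hp (m₁ := 1) (m₂ := 1) hM hΓ1 hΓ2)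

/-! ## D. The Bubble cell at a general apex with an apex-uniform trail-word COUNT MAJORANT, and the four
`⨆ v` entries of `A♯` (rows `c = 2`: all `v`; rows `c = 1`: the `2d` unit vectors `v`, weighted by `twoDD v`) -/

/-- The (5.40) right-hand side at PRINTED constants with the trail-word count `#trailWordsTo d L x` replaced by a
majorant `N L` (so that it is uniform in the apex `x`): `Σ_{L∈[m₁+m₂,M)} (L+1−m₁−m₂)·N(L)·p^L +
(M−m₁−m₂)·((2d/(2d−1))Γ₁)^M·((2d−2)/(2d−1))Γ₂·K_{1,M}(0) + ((2d/(2d−1))Γ₁)^M·(((2d−2)/(2d−1))Γ₂)²·K_{2,M}(0)`.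
[cite: FitznerVanDerHofstad2016NoBLE, §5.3.2 (5.40) p. 1098 with §5.3.1 (5.13) p. 1092]
[cite: FitznerVanDerHofstad2017, §4.2 (4.16); notebook Percolation.nb `Bound[Bubble,n,s]`] -/
def bubblePrintedRN (d : ℕ) (p Γ₁ Γ₂ : ℝ) (m₁ m₂ M : ℕ) (N : ℕ → ℕ) : ℝ :=
  (∑ L ∈ Finset.Ico (m₁ + m₂) M, ((L + 1 - m₁ - m₂ : ℕ) : ℝ) * (N L : ℝ) * p ^ L) +
    ((M - m₁ - m₂ : ℕ) : ℝ) * ((2 * d / (2 * d - 1) * Γ₁) ^ M * ((2 * d - 2) / (2 * d - 1) * Γ₂ * srwK d 1 M 0)) +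
      (2 * d / (2 * d - 1) * Γ₁) ^ M * (((2 * d - 2) / (2 * d - 1) * Γ₂) ^ 2 * srwK d 2 M 0)

/-- **The Bubble cell at a general apex `x`, printed constants, count majorant `N`** (`d ≥ 5`, `p < p_c`,
`m₂ ≤ M`, `#trailWordsTo d L x ≤ N L` for all `L`): `Σ_{y∈S} 𝓑_{m₁,m₂}(y,x) ≤ bubblePrintedRN d p Γ₁ Γ₂ m₁ m₂ M N`.
[cite: FitznerVanDerHofstad2016NoBLE, §5.3.2 (5.40) p. 1098; §5.3.1 (5.13) p. 1092]
[cite: FitznerVanDerHofstad2017, §4.2 (4.16)] -/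
theorem sum_repBubble_le_bubblePrintedRN (hd : 5 ≤ d) (p : unitInterval) (hp : p < criticalProbI d)
    {m₁ m₂ M : ℕ} (hm : m₂ ≤ M) {Γ₁ Γ₂ : ℝ} (hΓ1 : (2 * d - 1) * (p : ℝ) ≤ Γ₁) (hΓ2 : nobleF2 d p ≤ Γ₂)
    {x : Site d} {N : ℕ → ℕ} (hN : ∀ L, (trailWordsTo d L x).card ≤ N L) (S : Finset (Site d)) :
    ∑ y ∈ S, repBubble d p m₁ m₂ y x ≤ bubblePrintedRN d p Γ₁ Γ₂ m₁ m₂ M N := by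
  have hR₁ := isRemKernelConst_srwK_univ_of_eq (d := d) [M] (n := 1) (M := M) rfl (by simp) (by omega) (by omega)
  have hR₂ := isRemKernelConst_srwK_univ_of_eq (d := d) [M - m₂, m₂] (n := 2) (M := M) rfl
    (by simp; omega) (by omega) (by omega)
  refine (sum_repBubble_le_slots (by omega) p hp hm (Set.mem_univ x) hR₁ hR₂ S).trans ?_
  unfold bubblePrintedRN
  refine add_le_add (add_le_add (Finset.sum_le_sum fun L _ => ?_) ?_) ?_
  · exact mul_le_mul_of_nonneg_right
      (mul_le_mul_of_nonneg_left (by exact_mod_cast hN L) (Nat.cast_nonneg _)) (pow_nonneg p.2.1 L)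
  · refine mul_le_mul_of_nonneg_left ?_ (Nat.cast_nonneg _)
    simpa only [pow_one] using srwK_tail_le_printed (by omega) p hΓ1 hΓ2 1 M
  · exact srwK_tail_le_printed (by omega) p hΓ1 hΓ2 2 M

/-- `0 ≤ bubblePrintedRN d p Γ₁ Γ₂ m₁ m₂ M N` under the cell's hypotheses (the empty sum is below it).
[cite: FitznerVanDerHofstad2016NoBLE, §5.3.2 (5.40) p. 1098] -/
theorem bubblePrintedRN_nonneg (hd : 5 ≤ d) (p : unitInterval) (hp : p < criticalProbI d) {m₁ m₂ M : ℕ}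
    (hm : m₂ ≤ M) {Γ₁ Γ₂ : ℝ} (hΓ1 : (2 * d - 1) * (p : ℝ) ≤ Γ₁) (hΓ2 : nobleF2 d p ≤ Γ₂) {x : Site d}
    {N : ℕ → ℕ} (hN : ∀ L, (trailWordsTo d L x).card ≤ N L) : 0 ≤ bubblePrintedRN d p Γ₁ Γ₂ m₁ m₂ M N := by
  simpa using sum_repBubble_le_bubblePrintedRN hd p hp (m₁ := m₁) hm hΓ1 hΓ2 hN ∅

/-- **`Σ_y 𝓑_{≥m₁,≥m₂}(y,x) ≤ bubblePrintedRN d p Γ₁ Γ₂ m₁ m₂ M N` in `ℝ≥0∞`** for the instance's bubble letter at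
a general apex `x` with `#trailWordsTo d L x ≤ N L`. [cite: FitznerVanDerHofstad2016NoBLE, §5.3.2 (5.40) p. 1098]
[cite: FitznerVanDerHofstad2017, §4.2 (4.16)] -/
theorem tsum_perc_B_le_ofReal_of_count (hd : 5 ≤ d) (p : unitInterval) (hp : p < criticalProbI d)
    {m₁ m₂ M : ℕ} (hm : m₂ ≤ M) {Γ₁ Γ₂ : ℝ} (hΓ1 : (2 * d - 1) * (p : ℝ) ≤ Γ₁) (hΓ2 : nobleF2 d p ≤ Γ₂)
    {x : Site d} {N : ℕ → ℕ} (hN : ∀ L, (trailWordsTo d L x).card ≤ N L) :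
    ∑' y, (Letters.perc d p).B (.ge m₁) (.ge m₂) y x ≤ ENNReal.ofReal (bubblePrintedRN d p Γ₁ Γ₂ m₁ m₂ M N) := by
  rw [ENNReal.tsum_eq_iSup_sum]
  refine iSup_le fun S => ?_
  calc ∑ y ∈ S, (Letters.perc d p).B (.ge m₁) (.ge m₂) y x = ENNReal.ofReal (∑ y ∈ S, repBubble d p m₁ m₂ y x) := by
        rw [ENNReal.ofReal_sum_of_nonneg fun y _ => repBubble_nonneg p _ _ _ _]
        exact Finset.sum_congr rfl fun y _ => perc_B_ge p _ _ _ _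
    _ ≤ _ := ENNReal.ofReal_le_ofReal (sum_repBubble_le_bubblePrintedRN hd p hp hm hΓ1 hΓ2 hN S)

/-- The `y ≠ 0`-restricted bubble sum at a general apex, majorised by the full one and then by the cell:
`Σ_y kdc y 0 · 𝓑_{≥m₁,≥m₂}(y,x) ≤ bubblePrintedRN …`. [cite: FitznerVanDerHofstad2016NoBLE, §5.3.2 (5.40) p. 1098] -/
theorem tsum_kdc_perc_B_le_ofReal_of_count (hd : 5 ≤ d) (p : unitInterval) (hp : p < criticalProbI d)
    {m₁ m₂ M : ℕ} (hm : m₂ ≤ M) {Γ₁ Γ₂ : ℝ} (hΓ1 : (2 * d - 1) * (p : ℝ) ≤ Γ₁) (hΓ2 : nobleF2 d p ≤ Γ₂)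
    {x : Site d} {N : ℕ → ℕ} (hN : ∀ L, (trailWordsTo d L x).card ≤ N L) :
    ∑' y, kdc y 0 * (Letters.perc d p).B (.ge m₁) (.ge m₂) y x ≤
      ENNReal.ofReal (bubblePrintedRN d p Γ₁ Γ₂ m₁ m₂ M N) :=
  (ENNReal.tsum_le_tsum fun y => (mul_le_mul' (kdc_le_one y 0) le_rfl).trans_eq (one_mul _)).trans
    (tsum_perc_B_le_ofReal_of_count hd p hp hm hΓ1 hΓ2 hN)

/-- **Entry inequality `(A♯)_{2,2}` of [FvdH17] §5 (all apexes `v`):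
`sup_v Σ_{y ≠ 0} 𝓑_{≥2,≥1}(y,v) ≤ max (cell at the apex 0 with majorant N₀) (cell off 0 with majorant N₁)`**,
`N₀` majorising `#trailWordsTo d L 0` and `N₁` majorising `#trailWordsTo d L v` for every `v ≠ 0`
(`Bound[Bubble,3,s]`). [cite: FitznerVanDerHofstad2017, §5 matrix `A♯`, §4.2 (4.16); notebook Percolation.nb]
[cite: FitznerVanDerHofstad2016NoBLE, §5.3.2 (5.40) p. 1098] -/
theorem perc_ASharp_two_two_le_max (hd : 5 ≤ d) (p : unitInterval) (hp : p < criticalProbI d) {Γ₁ Γ₂ : ℝ}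
    (hΓ1 : (2 * d - 1) * (p : ℝ) ≤ Γ₁) (hΓ2 : nobleF2 d p ≤ Γ₂) {M : ℕ} (hM : 1 ≤ M) {N₀ N₁ : ℕ → ℕ}
    (hN₀ : ∀ L, (trailWordsTo d L (0 : Site d)).card ≤ N₀ L)
    (hN₁ : ∀ L (v : Site d), v ≠ 0 → (trailWordsTo d L v).card ≤ N₁ L) :
    (⨆ v, ∑' y, kdc y 0 * (Letters.perc d p).B (.ge 2) (.ge 1) y v) ≤
      max (ENNReal.ofReal (bubblePrintedRN d p Γ₁ Γ₂ 2 1 M N₀))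
        (ENNReal.ofReal (bubblePrintedRN d p Γ₁ Γ₂ 2 1 M N₁)) := by
  refine iSup_le fun v => ?_
  rcases eq_or_ne v 0 with rfl | hv
  · exact (tsum_kdc_perc_B_le_ofReal_of_count hd p hp hM hΓ1 hΓ2 hN₀).trans (le_max_left _ _)
  · exact (tsum_kdc_perc_B_le_ofReal_of_count hd p hp hM hΓ1 hΓ2 fun L => hN₁ L v hv).trans (le_max_right _ _)

/-- **Entry inequality `(A♯)_{2,1}` of [FvdH17] §5, GE-shape (all apexes `v`):
`sup_v Σ_{y ≠ 0} 𝓑_{1̲,≥1}(y,v) ≤ sup_v Σ_{y ≠ 0} 𝓑_{≥1,≥1}(y,v) ≤ max (cell (1,1) at 0, N₀) (cell (1,1) off 0, N₁)`**.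
[cite: FitznerVanDerHofstad2017, §5 matrix `A♯`, §4.2 (4.16); notebook Percolation.nb]
[cite: FitznerVanDerHofstad2016NoBLE, §5.3.2 (5.40) p. 1098] -/
theorem perc_ASharp_two_one_le_max (hd : 5 ≤ d) (p : unitInterval) (hp : p < criticalProbI d) {Γ₁ Γ₂ : ℝ}
    (hΓ1 : (2 * d - 1) * (p : ℝ) ≤ Γ₁) (hΓ2 : nobleF2 d p ≤ Γ₂) {M : ℕ} (hM : 1 ≤ M) {N₀ N₁ : ℕ → ℕ}
    (hN₀ : ∀ L, (trailWordsTo d L (0 : Site d)).card ≤ N₀ L)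
    (hN₁ : ∀ L (v : Site d), v ≠ 0 → (trailWordsTo d L v).card ≤ N₁ L) :
    (⨆ v, ∑' y, kdc y 0 * (Letters.perc d p).B (.eq 1) (.ge 1) y v) ≤
      max (ENNReal.ofReal (bubblePrintedRN d p Γ₁ Γ₂ 1 1 M N₀))
        (ENNReal.ofReal (bubblePrintedRN d p Γ₁ Γ₂ 1 1 M N₁)) :=
  (iSup_mono fun v => ENNReal.tsum_le_tsum fun y => mul_le_mul' le_rfl (percB_eq_one_le_ge_one p y v)).trans <| by
    refine iSup_le fun v => ?_
    rcases eq_or_ne v 0 with rfl | hv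
    · exact (tsum_kdc_perc_B_le_ofReal_of_count hd p hp hM hΓ1 hΓ2 hN₀).trans (le_max_left _ _)
    · exact (tsum_kdc_perc_B_le_ofReal_of_count hd p hp hM hΓ1 hΓ2 fun L => hN₁ L v hv).trans
        (le_max_right _ _)

/-- **Entry inequality `(A♯)_{1,2}` of [FvdH17] §5 (unit-vector apexes, weight `twoDD v = 𝟙{|v| = 1}`):
`sup_v 𝟙{|v|=1} Σ_{y ≠ 0} 𝓑_{≥2,≥1}(y,v) ≤ cell (2,1) with a majorant N of #trailWordsTo d L e over the 2d unit
vectors e`** (`Bound[Bubble,3,s]`). [cite: FitznerVanDerHofstad2017, §5 matrix `A♯`, §4.2 (4.16); notebook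
Percolation.nb] [cite: FitznerVanDerHofstad2016NoBLE, §5.3.2 (5.40) p. 1098] -/
theorem perc_ASharp_one_two_le_ofReal (hd : 5 ≤ d) (p : unitInterval) (hp : p < criticalProbI d) {Γ₁ Γ₂ : ℝ}
    (hΓ1 : (2 * d - 1) * (p : ℝ) ≤ Γ₁) (hΓ2 : nobleF2 d p ≤ Γ₂) {M : ℕ} (hM : 1 ≤ M) {N : ℕ → ℕ}
    (hN : ∀ L (ι : Fin d × Bool), (trailWordsTo d L (stepVec ι : Site d)).card ≤ N L) :
    (⨆ v, twoDD v * ∑' y, kdc y 0 * (Letters.perc d p).B (.ge 2) (.ge 1) y v) ≤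
      ENNReal.ofReal (bubblePrintedRN d p Γ₁ Γ₂ 2 1 M N) := by
  refine iSup_le fun v => ?_
  by_cases hv : ∃ ι : Fin d × Bool, v = stepVec ι
  · obtain ⟨ι, rfl⟩ := hv
    exact ((mul_le_mul' (twoDD_le_one _) le_rfl).trans_eq (one_mul _)).trans
      (tsum_kdc_perc_B_le_ofReal_of_count hd p hp hM hΓ1 hΓ2 fun L => hN L ι)
  · simp only [twoDD, if_neg hv, zero_mul, zero_le]

/-- **Entry inequality `(A♯)_{1,1}` of [FvdH17] §5, GE-shape (unit-vector apexes):
`sup_v 𝟙{|v|=1} Σ_{y ≠ 0} 𝓑_{1̲,≥1}(y,v) ≤ cell (1,1) with a unit-vector majorant N`**.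
[cite: FitznerVanDerHofstad2017, §5 matrix `A♯`, §4.2 (4.16); notebook Percolation.nb]
[cite: FitznerVanDerHofstad2016NoBLE, §5.3.2 (5.40) p. 1098] -/
theorem perc_ASharp_one_one_le_ofReal (hd : 5 ≤ d) (p : unitInterval) (hp : p < criticalProbI d) {Γ₁ Γ₂ : ℝ}
    (hΓ1 : (2 * d - 1) * (p : ℝ) ≤ Γ₁) (hΓ2 : nobleF2 d p ≤ Γ₂) {M : ℕ} (hM : 1 ≤ M) {N : ℕ → ℕ}
    (hN : ∀ L (ι : Fin d × Bool), (trailWordsTo d L (stepVec ι : Site d)).card ≤ N L) :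
    (⨆ v, twoDD v * ∑' y, kdc y 0 * (Letters.perc d p).B (.eq 1) (.ge 1) y v) ≤
      ENNReal.ofReal (bubblePrintedRN d p Γ₁ Γ₂ 1 1 M N) := by
  refine iSup_le fun v => ?_
  by_cases hv : ∃ ι : Fin d × Bool, v = stepVec ι
  · obtain ⟨ι, rfl⟩ := hv
    refine ((mul_le_mul' (twoDD_le_one _) le_rfl).trans_eq (one_mul _)).trans ?_
    exact (ENNReal.tsum_le_tsum fun y => mul_le_mul' le_rfl (percB_eq_one_le_ge_one p y _)).trans
      (tsum_kdc_perc_B_le_ofReal_of_count hd p hp hM hΓ1 hΓ2 fun L => hN L ι)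
  · simp only [twoDD, if_neg hv, zero_mul, zero_le]

/-- Consistency of the two currencies: with the EXACT count at the apex `0` the majorant form is the closed form,
`bubblePrintedRN d p Γ₁ Γ₂ m₁ m₂ M (fun L => #trailWordsTo d L 0) = bubblePrintedR d p Γ₁ Γ₂ m₁ m₂ M`.
[cite: FitznerVanDerHofstad2016NoBLE, §5.3.2 (5.40) p. 1098] -/
theorem bubblePrintedRN_count_zero (d : ℕ) (p Γ₁ Γ₂ : ℝ) (m₁ m₂ M : ℕ) :
    bubblePrintedRN d p Γ₁ Γ₂ m₁ m₂ M (fun L => (trailWordsTo d L (0 : Site d)).card) =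
      bubblePrintedR d p Γ₁ Γ₂ m₁ m₂ M := rfl

/-! ## E. Currency bridge to the landed generic module `NobleBubbleLetterSums` (rows 1–2 of `A♯`) -/

/-- **Currency bridge.** The generic (5.40) right-hand side `bubbleSlotR` of `NobleBubbleLetterSums` (count majorant
`N`, one-G factor `Γ̄₂ = nobleSup2 d p`, abstract kernel constants) instantiated with the PRINTED kernel constants
`R_n = (2d)^M K_{n,M}(0)` is below the printed form `bubblePrintedRN` (`(2dp)^M ≤ ((2d/(2d−1))Γ₁)^M`,
`Γ̄₂ ≤ ((2d−2)/(2d−1))Γ₂`; `srwK_tail_le_printed`): so every `iSup_*` / `tsum_kdc_perc_B_*` bound of that module taken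
at the printed constants is at most the corresponding `bubblePrintedRN` number.
[cite: FitznerVanDerHofstad2016NoBLE, §5.3.2 (5.40) p. 1098 with §5.3.1 (5.13) p. 1092 (printed constants)]
[cite: FitznerVanDerHofstad2017, §4.2 (4.16)] -/
theorem bubbleSlotR_printed_le_bubblePrintedRN (hd : 2 ≤ d) (p : unitInterval) {Γ₁ Γ₂ : ℝ}
    (hΓ1 : (2 * d - 1) * (p : ℝ) ≤ Γ₁) (hΓ2 : nobleF2 d p ≤ Γ₂) (m₁ m₂ M : ℕ) (N : ℕ → ℕ) :
    bubbleSlotR (p : ℝ) (nobleSup2 d p) m₁ m₂ M N ((2 * (d : ℝ)) ^ M * srwK d 1 M 0)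
        ((2 * (d : ℝ)) ^ M * srwK d 2 M 0) ≤ bubblePrintedRN d p Γ₁ Γ₂ m₁ m₂ M N := by
  unfold bubbleSlotR bubblePrintedRN
  refine add_le_add (add_le_add le_rfl ?_) ?_
  · refine mul_le_mul_of_nonneg_left ?_ (Nat.cast_nonneg _)
    simpa only [pow_one] using srwK_tail_le_printed hd p hΓ1 hΓ2 1 M
  · exact srwK_tail_le_printed hd p hΓ1 hΓ2 2 M

/-! ## F. FLOOR-tier forms of the `N = 1` entries `(P⃗^E)_1`, `(P⃗^S)_1` — the exact unit leg `1̲` read as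
`≥ 1` (`perc_T_le_floor`, `perc_B_le_floor`): the lossy tier in the landed Triangle / Bubble cells (the notebook's
sharper price of an exact leg — no free line for it — is NOT typed here) -/

/-- For the instance: `(P⃗^E)_1 ≤ Σ_x Σ_y 𝓣_{1,1,1}(x,y,0)` (the factors `(1−δ)` dropped, the exact middle leg
floored, §4.2 after (4.17)). [cite: FitznerVanDerHofstad2017, §5.1 Table "P^{E,b}" (arXiv:1506.07977v2 p. 47),
App. B (p. 73), §4.2 after (4.17) (p. 36)] -/
theorem perc_vecPE_one_le_tsum_floor (p : unitInterval) :
    vecPE (Letters.perc d p) 1 ≤ ∑' x, ∑' y, (Letters.perc d p).T (.ge 1) (.ge 1) (.ge 1) x y 0 := by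
  rw [vecPE_one]
  exact ENNReal.tsum_le_tsum fun x => ENNReal.tsum_le_tsum fun y =>
    (mul_le_mul' (mul_le_mul' (kdc_le_one x 0) (kdc_le_one y 0))
      (perc_T_le_floor p (.ge 1) (.eq 1) (.ge 1) x y 0)).trans_eq (by rw [one_mul, one_mul]; rfl)

/-- **FLOOR-tier entry inequality for `(P⃗^E)_1`**: `(P⃗^E)_1 ≤ ofReal (trianglePrintedR d p Γ₁ Γ₂ 3 M)` — the
Triangle cell with three free lines of total length `≥ 3` (notebook `Bound[Triangle,3,s]`; the notebook prices this
entry sharper, `Bound[PE,1] = Bound[Bubble,3]`, via the exact leg — not typed here). `7 ≤ d`, `p < p_c`, `2 ≤ M`.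
[cite: FitznerVanDerHofstad2017, §5.1 "Elements of the bounds" (arXiv:1506.07977v2 p. 49); notebook Percolation.nb
cell 16] [cite: FitznerVanDerHofstad2016NoBLE, §5.3.2 (5.41) p. 1098; §5.3.1 first paragraph after (5.38)] -/
theorem perc_vecPE_one_le_ofReal_floor (hd : 7 ≤ d) (p : unitInterval) (hp : p < criticalProbI d) {Γ₁ Γ₂ : ℝ}
    (hΓ1 : (2 * d - 1) * (p : ℝ) ≤ Γ₁) (hΓ2 : nobleF2 d p ≤ Γ₂) {M : ℕ} (hM : 2 ≤ M) :
    vecPE (Letters.perc d p) 1 ≤ ENNReal.ofReal (trianglePrintedR d p Γ₁ Γ₂ 3 M) :=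
  (perc_vecPE_one_le_tsum_floor p).trans
    (tsum_tsum_perc_T_zero_le_ofReal hd p hp (m₁ := 1) (m₂ := 1) (m₃ := 1) (by omega) hΓ1 hΓ2)

/-- For the instance: `(P⃗^S)_1 ≤ Σ_x 𝓑_{3,1}(x,0) + Σ_x Σ_y 𝓣_{1,1,1}(x,y,0)` (exact legs floored, `(1−δ)` dropped,
`tsum_add`). [cite: FitznerVanDerHofstad2017, App. B Table "definition of P^b(x,y)", row b = 1
(arXiv:1506.07977v2 p. 73); §4.2 after (4.17) (p. 36)] -/
theorem perc_vecPS_one_le_add_floor (p : unitInterval) :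
    vecPS (Letters.perc d p) 1 ≤ (∑' x, (Letters.perc d p).B (.ge 3) (.ge 1) x 0) +
      ∑' x, ∑' y, (Letters.perc d p).T (.ge 1) (.ge 1) (.ge 1) x y 0 := by
  rw [vecPS_one]
  calc ∑' x, kdc x 0 * ((Letters.perc d p).B (.ge 3) (.eq 1) x 0 +
          ∑' y, kdc y 0 * (Letters.perc d p).T (.ge 1) (.eq 1) (.ge 1) x y 0)
      ≤ ∑' x, ((Letters.perc d p).B (.ge 3) (.ge 1) x 0 + ∑' y, (Letters.perc d p).T (.ge 1) (.ge 1) (.ge 1) x y 0) :=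
        ENNReal.tsum_le_tsum fun x =>
          ((mul_le_mul' (kdc_le_one x 0) le_rfl).trans_eq (one_mul _)).trans
            (add_le_add (perc_B_le_floor p (.ge 3) (.eq 1) x 0) (ENNReal.tsum_le_tsum fun y =>
              (mul_le_mul' (kdc_le_one y 0) (perc_T_le_floor p (.ge 1) (.eq 1) (.ge 1) x y 0)).trans_eq
                (one_mul _)))
    _ = (∑' x, (Letters.perc d p).B (.ge 3) (.ge 1) x 0) +
          ∑' x, ∑' y, (Letters.perc d p).T (.ge 1) (.ge 1) (.ge 1) x y 0 := ENNReal.tsum_add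

/-- **FLOOR-tier entry inequality for `(P⃗^S)_1`**:
`(P⃗^S)_1 ≤ ofReal (bubblePrintedR d p Γ₁ Γ₂ 3 1 M + trianglePrintedR d p Γ₁ Γ₂ 3 M)` (Bubble cell at indices
`(3,1)` plus the Triangle cell of total length `≥ 3`; notebook `Bound[PS,1] = Bound[Loop,4] + Bound[Bubble,3]` is the
sharper exact-leg price — not typed here). `7 ≤ d`, `p < p_c`, `2 ≤ M`.
[cite: FitznerVanDerHofstad2017, §5.1 "Elements of the bounds" (arXiv:1506.07977v2 p. 49); notebook Percolation.nb
cell 16] [cite: FitznerVanDerHofstad2016NoBLE, §5.3.2 (5.40), (5.41) p. 1098] -/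
theorem perc_vecPS_one_le_ofReal_floor (hd : 7 ≤ d) (p : unitInterval) (hp : p < criticalProbI d) {Γ₁ Γ₂ : ℝ}
    (hΓ1 : (2 * d - 1) * (p : ℝ) ≤ Γ₁) (hΓ2 : nobleF2 d p ≤ Γ₂) {M : ℕ} (hM : 2 ≤ M) :
    vecPS (Letters.perc d p) 1 ≤
      ENNReal.ofReal (bubblePrintedR d p Γ₁ Γ₂ 3 1 M + trianglePrintedR d p Γ₁ Γ₂ 3 M) := by
  have hB := bubblePrintedR_nonneg (by omega) p hp (m₁ := 3) (m₂ := 1) (M := M) (by omega) hΓ1 hΓ2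
  have hT := trianglePrintedR_nonneg hd p hp (m₁ := 1) (m₂ := 1) (m₃ := 1) (M := M) (by omega) hΓ1 hΓ2
  rw [ENNReal.ofReal_add hB hT]
  exact (perc_vecPS_one_le_add_floor p).trans (add_le_add
    (tsum_perc_B_zero_le_ofReal (by omega) p hp (m₁ := 3) (m₂ := 1) (by omega) hΓ1 hΓ2)
    (tsum_tsum_perc_T_zero_le_ofReal hd p hp (m₁ := 1) (m₂ := 1) (m₃ := 1) (by omega) hΓ1 hΓ2))

end Literature.Probability.FitznerVanDerHofstad2017

end
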